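import Literature.MathematicalPhysics.QuantumLattice.TranslationInvariantGroundStatesAreMeanEnergyMinimisers
import Literature.MathematicalPhysics.QuantumLattice.HubbardOneBandHoppingFamilies
import Literature.MathematicalPhysics.QuantumLattice.DWaveSourceEnergyDensityTPPTransport
import Literature.MathematicalPhysics.QuantumLattice.HubbardBilayerByDecoration
import HarnessLib

/-!
# Bratteli–Kishimoto–Robinson's Theorem 2 for the one-band hopping families
# (`t–t'–t''`, `t–t'–t''–t‴`, general finite hopping sets, pair-sourced `t–t'–t''`)

Topic `Literature/MathematicalPhysics/QuantumLattice`; namespace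
`Literature.MathematicalPhysics.QuantumLattice` (the file path). Sequel of
`HubbardTTPrimeMeanEnergyMinimisers.lean` / `HubbardTTPrimeSourcedMeanEnergyMinimisers.lean` (the four
structural properties — even, Hermitian, TRANSLATION INVARIANT, FINITE RANGE — and Theorem 2 by name
for `Φ(t,U)`, `Φ(t,t',U)`, `Φ(t,t',U) − μn`, `Φ(t,t',U) − μn − hP_g`) and of
`TranslationInvariantGroundStatesAreMeanEnergyMinimisers.lean` (Theorem 2 as an `iff` for every even,
Hermitian, translation-invariant, finite-range interaction, `isMeanEnergyMinimiser_iff_isGroundState`).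
Here the same is done for the ONE-BAND HOPPING FAMILIES of the tree — the models a downfolded material
box hands to the certifier (stage S2 «families of models»: `t, t', t''` and the knight amplitude `t‴`
of the Wannier fits, Pavarini et al. 2001 eq. (1)):

* §1 the hopping interaction along one lattice vector `Φ_v^{t}` (`vectorHoppingFermionInteraction`):
  translation invariant (`v ≠ 0`) and of range `‖v‖_∞`; the axial range-2 hopping `Φ''`
  (`axialRange2HoppingFermionInteraction`): translation invariant, range `2`; the Hubbard interaction
  WITHOUT hopping, `Φ(0,U)`, has range `0`; monotonicity of `HasFiniteRange` in the radius.
* §2 hopping PAIR directions `Φ_{v,w}` and the general family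
  `hubbardHoppingFamily τ₁ τ₂ U θ = Φ(0,U) + Σ_a θ_a Φ_{τ₁ a, τ₂ a}`: translation invariant when all
  jump vectors are nonzero, of range `R` when all jump vectors have `‖·‖_∞ ≤ R` (`R ≥ 0`).
* §3 the square lattice: the five standard jump pairs are nonzero and lie in `[-2,2]²`; the
  `t–t'–t''` interaction, the `t–t'–t''–t‴` interaction and the pair-sourced `t–t'–t''` interaction
  (`hubbardTT'T''SourcedInteraction`, object M of the material boxes) are even, Hermitian, translation
  invariant and of range `2`.
* §4 **Theorem 2 by name** (`d ≥ 1` resp. `d = 2`): `isMeanEnergyMinimiser_hubbardHoppingFamily_iff`,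
  `isMeanEnergyMinimiser_ttPrimeTPP_iff`, `isMeanEnergyMinimiser_ttPrimeTPPTPPP_iff`,
  `isMeanEnergyMinimiser_ttPrimeTPPSourced_iff` — a state minimises the mean energy of the model iff it
  is a translation-invariant ground state of it (Bratteli–Robinson condition `-iω(A⋆δ(A)) ≥ 0`); both
  one-directional forms are also given. So every ground-state row of the tree (stationarity, the
  Bratteli–Robinson inequality, the local minimum-energy principle, the canonical-class reading) is
  available BY NAME for every one-band model with hoppings up to the knight move.

Everything is PROVED; no definition, no named fact.

## References

* O. Bratteli, A. Kishimoto, D. W. Robinson, Commun. Math. Phys. **64** (1978) 41–48, Thm. 2 (p. 47).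
  [cite: BratteliKishimotoRobinson1978, Thm. 2]
* H. Araki, H. Moriya, Rev. Math. Phys. 15 (2003) 93, §1 assumptions (II), (IV), §5.4 (even,
  translation covariant, finite-range potentials). [cite: ArakiMoriya2003, §1 and §5.4]
* E. Pavarini, I. Dasgupta, T. Saha-Dasgupta, O. Jepsen, O. K. Andersen, Phys. Rev. Lett. 87 (2001)
  047003, eq. (1) (the one-band `t, t', t''` model of the cuprates). [cite: PavariniEtAl2001, eq. (1)]
-/

noncomputable section

namespace Literature.MathematicalPhysics.QuantumLattice

open Matrix Finset HubbardWave0 Literature.Probability.LatticeModels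
open scoped ComplexOrder

variable {d : ℕ}

/-! ### §1. One jump vector: translation invariance and range -/

/-- **`HasFiniteRange` is monotone in the radius**: range `R` implies range `R'` for `R ≤ R'`.
[cite: ArakiMoriya2003, §5.4 (finite range potentials)] -/
theorem FermionInteraction.HasFiniteRange.of_le {Ψ : FermionInteraction d} {R R' : ℝ}
    (h : Ψ.HasFiniteRange R) (hle : R ≤ R') : Ψ.HasFiniteRange R' :=
  fun X hX => h X (lt_of_le_of_lt hle hX)

/-- A jump vector in the range box `thicken {0} R` (`R ≥ 0`) has sup norm `≤ R`.
[cite: ArakiMoriya2003, §5.4 (finite range)] -/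
theorem norm_le_of_mem_thicken_zero {R : ℝ} (hR : 0 ≤ R) {v : Site d}
    (hv : v ∈ thicken ({0} : Finset (Site d)) R) : ‖v‖ ≤ R := by
  rw [mem_thicken_zero_iff] at hv
  have hf : ((⌊R⌋₊ : ℕ) : ℝ) ≤ R := Nat.floor_le hR
  refine (pi_norm_le_iff_of_nonneg hR).2 fun i => ?_
  have h1 : ((v i : ℤ) : ℝ) ≤ ((⌊R⌋₊ : ℕ) : ℤ) := by exact_mod_cast (hv i).2
  have h2 : (-((⌊R⌋₊ : ℕ) : ℤ) : ℝ) ≤ ((v i : ℤ) : ℝ) := by exact_mod_cast (hv i).1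
  push_cast at h1 h2
  rw [Int.norm_eq_abs, abs_le]
  exact ⟨by linarith, by linarith⟩

section Vector

variable {v : Site d} (hv : v ≠ 0) (t : ℝ)
include hv

/-- Bond term of `Φ_v` at a region known to be a bond `S = {y, z}`, `z = y + v`.
[cite: PavariniEtAl2001, eq. (1)] -/
theorem vectorHoppingFermionInteraction_apply_of_eq_pair {S : Finset (Site d)} {y z : Site d}
    (hS : S = {y, z}) (hz : z = y + v) (hy : y ∈ S) (hz' : z ∈ S) :
    (vectorHoppingFermionInteraction d v t).Φ S =
      -(t : ℂ) • ∑ σ : Fin 2, ((cAt y hy σ)ᴴ * cAt z hz' σ + (cAt z hz' σ)ᴴ * cAt y hy σ) := by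
  subst hz; subst hS
  exact vectorHoppingFermionInteraction_apply_pair hv t y

/-- **The hopping interaction along `v ≠ 0` is translation invariant**: `Φ_v(X + w) = Γ(τ_w)(Φ_v X)`.
[cite: ArakiMoriya2003, §1 assumption (IV) and §8] -/
theorem vectorHoppingFermionInteraction_isTranslationInvariant :
    (vectorHoppingFermionInteraction d v t).IsTranslationInvariant := by
  intro w X
  by_cases h2 : ∃ x : Site d, X = {x, x + v}
  · obtain ⟨x, rfl⟩ := h2
    rw [vectorHoppingFermionInteraction_apply_of_eq_pair hv t (shiftSet_pair_eq w x (x + v))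
        (add_right_comm x v w) (PolySite.add_mem_shiftSet w (Finset.mem_insert_self _ _))
        (PolySite.add_mem_shiftSet w (Finset.mem_insert_of_mem (Finset.mem_singleton_self _))),
      vectorHoppingFermionInteraction_apply_pair hv t, map_smul, map_sum]
    simp only [map_add, map_mul, fermionEmbed_conjTranspose, fermionEmbed_shiftEmb_cAt]
  have hX : (vectorHoppingFermionInteraction d v t).Φ X = 0 :=
    vectorHoppingFermionInteraction_apply_eq_zero t fun x hx => h2 ⟨x, hx⟩
  have hS : (vectorHoppingFermionInteraction d v t).Φ (shiftSet w X) = 0 := by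
    refine vectorHoppingFermionInteraction_apply_eq_zero t fun y hy => h2 ⟨y - w, ?_⟩
    rw [eq_pair_of_shiftSet_eq hy, add_sub_right_comm]
  rw [hX, hS, map_zero]

end Vector

/-- **The hopping interaction along `v` has range `‖v‖_∞`** (its only regions are the bonds
`{x, x + v}`, of diameter `‖v‖`). [cite: ArakiMoriya2003, §5.4 (finite range potentials)] -/
theorem vectorHoppingFermionInteraction_hasFiniteRange (v : Site d) (t : ℝ) :
    (vectorHoppingFermionInteraction d v t).HasFiniteRange ‖v‖ := by
  intro X hX
  refine vectorHoppingFermionInteraction_apply_eq_zero t fun x hx => ?_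
  subst hx
  rw [diam_coe_pair_add] at hX
  exact lt_irrefl _ hX

/-- `‖2e_i‖ = 2` in the sup norm of `ℤ^d`. [cite: ArakiMoriya2003, §5.4 (finite range)] -/
theorem norm_axial2Vec (i : Fin d) : ‖(axial2Vec i : Site d)‖ = 2 := by
  rw [axial2Vec, Pi.norm_single, Int.norm_eq_abs]
  norm_num

/-- Axial range-2 bond term at a region known to be a bond `S = {y, z}`, `z = y + 2e_i`.
[cite: PavariniEtAl2001, eq. (1)] -/
theorem axialRange2HoppingFermionInteraction_apply_of_eq_pair (t'' : ℝ) {S : Finset (Site d)}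
    {y z : Site d} {i : Fin d} (hS : S = {y, z}) (hz : z = y + axial2Vec i) (hy : y ∈ S) (hz' : z ∈ S) :
    (axialRange2HoppingFermionInteraction d t'').Φ S =
      -(t'' : ℂ) • ∑ σ : Fin 2, ((cAt y hy σ)ᴴ * cAt z hz' σ + (cAt z hz' σ)ᴴ * cAt y hy σ) := by
  subst hz; subst hS
  exact axialRange2HoppingFermionInteraction_apply_pair t'' y i

/-- **The axial range-2 hopping interaction is translation invariant.**
[cite: ArakiMoriya2003, §1 assumption (IV) and §8] -/
theorem axialRange2HoppingFermionInteraction_isTranslationInvariant (t'' : ℝ) :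
    (axialRange2HoppingFermionInteraction d t'').IsTranslationInvariant := by
  intro v X
  by_cases h3 : ∃ (x : Site d) (i : Fin d), X = {x, x + axial2Vec i}
  · obtain ⟨x, i, rfl⟩ := h3
    rw [axialRange2HoppingFermionInteraction_apply_of_eq_pair t'' (shiftSet_pair_eq v x (x + axial2Vec i))
        (add_right_comm x (axial2Vec i) v) (PolySite.add_mem_shiftSet v (Finset.mem_insert_self _ _))
        (PolySite.add_mem_shiftSet v (Finset.mem_insert_of_mem (Finset.mem_singleton_self _))),
      axialRange2HoppingFermionInteraction_apply_pair, map_smul, map_sum]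
    simp only [map_add, map_mul, fermionEmbed_conjTranspose, fermionEmbed_shiftEmb_cAt]
  have hX : (axialRange2HoppingFermionInteraction d t'').Φ X = 0 :=
    axialRange2HoppingFermionInteraction_apply_eq_zero t'' (fun x i hx => h3 ⟨x, i, hx⟩)
  have hS : (axialRange2HoppingFermionInteraction d t'').Φ (shiftSet v X) = 0 := by
    refine axialRange2HoppingFermionInteraction_apply_eq_zero t'' (fun y i hy => h3 ⟨y - v, i, ?_⟩)
    rw [eq_pair_of_shiftSet_eq hy, add_sub_right_comm]
  rw [hX, hS, map_zero]

/-- **The axial range-2 hopping interaction has range `2`.** [cite: ArakiMoriya2003, §5.4 (finite range potentials)] -/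
theorem axialRange2HoppingFermionInteraction_hasFiniteRange (t'' : ℝ) :
    (axialRange2HoppingFermionInteraction d t'').HasFiniteRange 2 := by
  intro X hX
  refine axialRange2HoppingFermionInteraction_apply_eq_zero t'' (fun x i hx => ?_)
  subst hx
  rw [diam_coe_pair_add, norm_axial2Vec] at hX
  exact lt_irrefl _ hX

/-- **Without hopping the Hubbard interaction is on-site**: `Φ(0, U)` has range `0` (its bond terms
carry the amplitude `t = 0`). [cite: ArakiMoriya2003, §5.4 (finite range potentials)] -/
theorem hubbardFermionInteraction_hasFiniteRange_zero_of_hopping_zero (U : ℝ) :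
    (hubbardFermionInteraction d 0 U).HasFiniteRange 0 := by
  intro X hX
  by_cases h2 : ∃ (x : Site d) (i : Fin d), X = {x, x + unitVec i}
  · obtain ⟨x, i, rfl⟩ := h2
    rw [hubbardFermionInteraction_apply_pair, Complex.ofReal_zero, neg_zero, zero_smul]
  refine hubbardFermionInteraction_apply_eq_zero 0 U (fun x hx => ?_) (fun x i hx => h2 ⟨x, i, hx⟩)
  subst hx
  rw [Finset.coe_singleton, Metric.diam_singleton] at hX
  exact lt_irrefl _ hX

/-! ### §2. Hopping pairs and the general one-band family -/

/-- **A hopping pair direction with nonzero jumps is translation invariant.**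
[cite: ArakiMoriya2003, §1 assumption (IV) and §8] -/
theorem hoppingPairInteraction_isTranslationInvariant {v w : Site d} (hv : v ≠ 0) (hw : w ≠ 0) :
    (hoppingPairInteraction d v w).IsTranslationInvariant :=
  FermionInteraction.isTranslationInvariant_of_add (hoppingPairInteraction_apply v w)
    (vectorHoppingFermionInteraction_isTranslationInvariant hv 1)
    (vectorHoppingFermionInteraction_isTranslationInvariant hw 1)

/-- **A hopping pair direction has range `R`** whenever both jumps have sup norm `≤ R`.
[cite: ArakiMoriya2003, §5.4 (finite range potentials)] -/
theorem hoppingPairInteraction_hasFiniteRange {v w : Site d} {R : ℝ} (hv : ‖v‖ ≤ R) (hw : ‖w‖ ≤ R) :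
    (hoppingPairInteraction d v w).HasFiniteRange R :=
  FermionInteraction.hasFiniteRange_of_add (hoppingPairInteraction_apply v w)
    ((vectorHoppingFermionInteraction_hasFiniteRange v 1).of_le hv)
    ((vectorHoppingFermionInteraction_hasFiniteRange w 1).of_le hw)

section Family

variable {ι : Type*} [Fintype ι] {τ₁ τ₂ : ι → Site d}

/-- **The one-band family `Φ(0,U) + Σ_a θ_a Φ_{τ₁ a, τ₂ a}` is translation invariant** (all jump vectors
nonzero). [cite: ArakiMoriya2003, §1 assumption (IV) and §8] -/
theorem hubbardHoppingFamily_isTranslationInvariant (hτ : ∀ a, τ₁ a ≠ 0 ∧ τ₂ a ≠ 0) (U : ℝ)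
    (θ : ι → ℝ) : (hubbardHoppingFamily τ₁ τ₂ U θ).IsTranslationInvariant :=
  FermionInteraction.isTranslationInvariant_linearFamily (hubbardFermionInteraction_isTranslationInvariant 0 U)
    (fun a => hoppingPairInteraction_isTranslationInvariant (hτ a).1 (hτ a).2) θ

/-- **The one-band family has range `R`** (`R ≥ 0`) when every jump vector has sup norm `≤ R`.
[cite: ArakiMoriya2003, §5.4 (finite range potentials)] -/
theorem hubbardHoppingFamily_hasFiniteRange {R : ℝ} (hR : 0 ≤ R) (hτ : ∀ a, ‖τ₁ a‖ ≤ R ∧ ‖τ₂ a‖ ≤ R)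
    (U : ℝ) (θ : ι → ℝ) : (hubbardHoppingFamily τ₁ τ₂ U θ).HasFiniteRange R :=
  FermionInteraction.hasFiniteRange_linearFamily
    ((hubbardFermionInteraction_hasFiniteRange_zero_of_hopping_zero U).of_le hR)
    (fun a => hoppingPairInteraction_hasFiniteRange (hτ a).1 (hτ a).2) θ

end Family

/-! ### §3. The square lattice: `t–t'–t''`, `t–t'–t''–t‴`, pair-sourced `t–t'–t''` -/

/-- Every knight jump is nonzero. [cite: PavariniEtAl2001, eq. (1)] -/
theorem knightVec_ne_zero (k : Fin 4) : knightVec k ≠ 0 := fun h => by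
  have h0 := congrFun h 0
  fin_cases k <;> simp [knightVec] at h0

/-- The five standard first jumps `e₁, e₁+e₂, 2e₁, (2,1), (2,−1)` are nonzero. [cite: PavariniEtAl2001, eq. (1)] -/
theorem cuprateHopPair₁_ne_zero (a : Fin 5) : cuprateHopPair₁ a ≠ 0 := by
  fin_cases a
  · exact uvec_ne_zero 0
  · exact diagVec_ne_zero 0
  · exact axial2Vec_ne_zero 0
  · exact knightVec_ne_zero 0
  · exact knightVec_ne_zero 2

/-- The five standard second jumps `e₂, e₁−e₂, 2e₂, (1,2), (1,−2)` are nonzero. [cite: PavariniEtAl2001, eq. (1)] -/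
theorem cuprateHopPair₂_ne_zero (a : Fin 5) : cuprateHopPair₂ a ≠ 0 := by
  fin_cases a
  · exact uvec_ne_zero 1
  · exact diagVec_ne_zero 1
  · exact axial2Vec_ne_zero 1
  · exact knightVec_ne_zero 1
  · exact knightVec_ne_zero 3

/-- The standard jumps have sup norm `≤ 2` (they lie in the range box `[-2,2]²`).
[cite: ArakiMoriya2003, §5.4 (finite range)] -/
theorem norm_cuprateHopPair_le_two (a : Fin 5) : ‖cuprateHopPair₁ a‖ ≤ 2 ∧ ‖cuprateHopPair₂ a‖ ≤ 2 :=
  ⟨norm_le_of_mem_thicken_zero zero_le_two (cuprateHopPair₁_mem_thicken_two a),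
    norm_le_of_mem_thicken_zero zero_le_two (cuprateHopPair₂_mem_thicken_two a)⟩

section Square

variable (t t' t'' t''' U μ : ℝ) (g : Site 2 → ℝ) (h : ℝ)

/-- **The `t–t'–t''` interaction is translation invariant.** [cite: ArakiMoriya2003, §1 assumption (IV) and §8] -/
theorem hubbardTT'T''FermionInteraction_isTranslationInvariant :
    (hubbardTT'T''FermionInteraction t t' t'' U).IsTranslationInvariant :=
  FermionInteraction.isTranslationInvariant_pencil (hubbardTTPrimeFermionInteraction_isTranslationInvariant t t' U)
    (axialRange2HoppingFermionInteraction_isTranslationInvariant 1) t''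

/-- **The `t–t'–t''` interaction has range `2`.** [cite: ArakiMoriya2003, §5.4 (finite range potentials)] -/
theorem hubbardTT'T''FermionInteraction_hasFiniteRange :
    (hubbardTT'T''FermionInteraction t t' t'' U).HasFiniteRange 2 :=
  FermionInteraction.hasFiniteRange_pencil ((hubbardTTPrimeFermionInteraction_hasFiniteRange t t' U).of_le one_le_two)
    (axialRange2HoppingFermionInteraction_hasFiniteRange 1) t''

/-- The `t–t'–t''–t‴` interaction is even. [cite: ArakiMoriya2003, §1 assumption (II)] -/
theorem hubbardTT'T''T'''FermionInteraction_isEven : (hubbardTT'T''T'''FermionInteraction t t' t'' t''' U).IsEven :=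
  hubbardHoppingFamily_isEven cuprateHopPair₁ cuprateHopPair₂ U _

/-- The `t–t'–t''–t‴` interaction is Hermitian (real couplings). [cite: PavariniEtAl2001, eq. (1)] -/
theorem hubbardTT'T''T'''FermionInteraction_isHermitian :
    (hubbardTT'T''T'''FermionInteraction t t' t'' t''' U).IsHermitian :=
  hubbardHoppingFamily_isHermitian cuprateHopPair₁ cuprateHopPair₂ U _

/-- **The `t–t'–t''–t‴` interaction is translation invariant.** [cite: ArakiMoriya2003, §1 assumption (IV) and §8] -/
theorem hubbardTT'T''T'''FermionInteraction_isTranslationInvariant :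
    (hubbardTT'T''T'''FermionInteraction t t' t'' t''' U).IsTranslationInvariant :=
  hubbardHoppingFamily_isTranslationInvariant (fun a => ⟨cuprateHopPair₁_ne_zero a, cuprateHopPair₂_ne_zero a⟩) U _

/-- **The `t–t'–t''–t‴` interaction has range `2`** (the knight jump `(2, ±1)` has sup norm `2`).
[cite: ArakiMoriya2003, §5.4 (finite range potentials)] -/
theorem hubbardTT'T''T'''FermionInteraction_hasFiniteRange :
    (hubbardTT'T''T'''FermionInteraction t t' t'' t''' U).HasFiniteRange 2 :=
  hubbardHoppingFamily_hasFiniteRange zero_le_two norm_cuprateHopPair_le_two U _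

/-- The pair-sourced `t–t'–t''` interaction (object M) is even. [cite: ArakiMoriya2003, §1 assumption (II)] -/
theorem hubbardTT'T''SourcedInteraction_isEven : (hubbardTT'T''SourcedInteraction t t' t'' U μ g h).IsEven :=
  FermionInteraction.isEven_pencil (hubbardTTPrimeSourcedInteraction_isEven t t' U μ g h)
    (axialRange2HoppingFermionInteraction_isEven 1) t''

/-- The pair-sourced `t–t'–t''` interaction is Hermitian. [cite: PavariniEtAl2001, eq. (1)] -/
theorem hubbardTT'T''SourcedInteraction_isHermitian :
    (hubbardTT'T''SourcedInteraction t t' t'' U μ g h).IsHermitian :=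
  FermionInteraction.isHermitian_pencil (hubbardTTPrimeSourcedInteraction_isHermitian t t' U μ g h)
    (axialRange2HoppingFermionInteraction_isHermitian 1) t''

/-- **The pair-sourced `t–t'–t''` interaction is translation invariant** (constant source amplitude).
[cite: ArakiMoriya2003, §1 assumption (IV) and §8] -/
theorem hubbardTT'T''SourcedInteraction_isTranslationInvariant :
    (hubbardTT'T''SourcedInteraction t t' t'' U μ g h).IsTranslationInvariant :=
  FermionInteraction.isTranslationInvariant_pencil
    (hubbardTTPrimeSourcedInteraction_isTranslationInvariant t t' U μ g h)
    (axialRange2HoppingFermionInteraction_isTranslationInvariant 1) t''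

/-- **The pair-sourced `t–t'–t''` interaction has range `2`.** [cite: ArakiMoriya2003, §5.4 (finite range potentials)] -/
theorem hubbardTT'T''SourcedInteraction_hasFiniteRange :
    (hubbardTT'T''SourcedInteraction t t' t'' U μ g h).HasFiniteRange 2 :=
  FermionInteraction.hasFiniteRange_pencil
    ((hubbardTTPrimeSourcedInteraction_hasFiniteRange t t' U μ g h).of_le one_le_two)
    (axialRange2HoppingFermionInteraction_hasFiniteRange 1) t''

end Square

/-! ### §4. Bratteli–Kishimoto–Robinson's Theorem 2 for the one-band families, by name -/

namespace InfVolFermionState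

section Family

variable {ι : Type*} [Fintype ι] {τ₁ τ₂ : ι → Site d} {U : ℝ} {θ : ι → ℝ} {R : ℝ}
  {ω : InfVolFermionState d}

/-- **`1 ⇒ 2` for the one-band family** `Φ(0,U) + Σ_a θ_a Φ_{τ₁ a, τ₂ a}` (jumps nonzero, of sup norm
`≤ R`, `R ≥ 0`): a translation-invariant ground state minimises the mean energy.
[cite: BratteliKishimotoRobinson1978, Thm. 2] -/
theorem IsGroundState.isMeanEnergyMinimiser_hubbardHoppingFamily (hR : 0 ≤ R)
    (hτ0 : ∀ a, τ₁ a ≠ 0 ∧ τ₂ a ≠ 0) (hτ : ∀ a, ‖τ₁ a‖ ≤ R ∧ ‖τ₂ a‖ ≤ R)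
    (hω : ω.IsTranslationInvariant) (hgs : ω.IsGroundState (hubbardHoppingFamily τ₁ τ₂ U θ) R) :
    ω.IsMeanEnergyMinimiser (hubbardHoppingFamily τ₁ τ₂ U θ) R :=
  hgs.isMeanEnergyMinimiser (hubbardHoppingFamily_hasFiniteRange hR hτ U θ)
    (hubbardHoppingFamily_isEven τ₁ τ₂ U θ) (hubbardHoppingFamily_isTranslationInvariant hτ0 U θ) hω

/-- **`2 ⇒ 1` for the one-band family** (`d ≥ 1`): a minimiser of its mean energy is a ground state.
[cite: BratteliKishimotoRobinson1978, Thm. 2] -/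
theorem IsMeanEnergyMinimiser.isGroundState_hubbardHoppingFamily (hd : 0 < d) (hR : 0 ≤ R)
    (hτ0 : ∀ a, τ₁ a ≠ 0 ∧ τ₂ a ≠ 0) (hτ : ∀ a, ‖τ₁ a‖ ≤ R ∧ ‖τ₂ a‖ ≤ R)
    (hmin : ω.IsMeanEnergyMinimiser (hubbardHoppingFamily τ₁ τ₂ U θ) R) :
    ω.IsGroundState (hubbardHoppingFamily τ₁ τ₂ U θ) R :=
  hmin.isGroundState hd (hubbardHoppingFamily_hasFiniteRange hR hτ U θ)
    (hubbardHoppingFamily_isHermitian τ₁ τ₂ U θ) (hubbardHoppingFamily_isEven τ₁ τ₂ U θ)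
    (hubbardHoppingFamily_isTranslationInvariant hτ0 U θ)

/-- **Theorem 2 for the one-band family** (`d ≥ 1`, jumps nonzero and of sup norm `≤ R`, `R ≥ 0`):
`ω` minimises the mean energy of `Φ(0,U) + Σ_a θ_a Φ_{τ₁ a, τ₂ a}` iff `ω` is a translation-invariant
ground state of it. [cite: BratteliKishimotoRobinson1978, Thm. 2] -/
theorem isMeanEnergyMinimiser_hubbardHoppingFamily_iff (hd : 0 < d) (hR : 0 ≤ R)
    (hτ0 : ∀ a, τ₁ a ≠ 0 ∧ τ₂ a ≠ 0) (hτ : ∀ a, ‖τ₁ a‖ ≤ R ∧ ‖τ₂ a‖ ≤ R) :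
    ω.IsMeanEnergyMinimiser (hubbardHoppingFamily τ₁ τ₂ U θ) R ↔
      ω.IsTranslationInvariant ∧ ω.IsGroundState (hubbardHoppingFamily τ₁ τ₂ U θ) R :=
  isMeanEnergyMinimiser_iff_isGroundState hd (hubbardHoppingFamily_hasFiniteRange hR hτ U θ)
    (hubbardHoppingFamily_isHermitian τ₁ τ₂ U θ) (hubbardHoppingFamily_isEven τ₁ τ₂ U θ)
    (hubbardHoppingFamily_isTranslationInvariant hτ0 U θ)

end Family

section Square

variable {t t' t'' t''' U μ : ℝ} {g : Site 2 → ℝ} {h : ℝ} {ω : InfVolFermionState 2}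

/-- **`1 ⇒ 2` for the `t–t'–t''` model** (range `2`). [cite: BratteliKishimotoRobinson1978, Thm. 2] -/
theorem IsGroundState.isMeanEnergyMinimiser_ttPrimeTPP (hω : ω.IsTranslationInvariant)
    (hgs : ω.IsGroundState (hubbardTT'T''FermionInteraction t t' t'' U) 2) :
    ω.IsMeanEnergyMinimiser (hubbardTT'T''FermionInteraction t t' t'' U) 2 :=
  hgs.isMeanEnergyMinimiser (hubbardTT'T''FermionInteraction_hasFiniteRange t t' t'' U)
    (hubbardTT'T''FermionInteraction_isEven t t' t'' U)
    (hubbardTT'T''FermionInteraction_isTranslationInvariant t t' t'' U) hω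

/-- **`2 ⇒ 1` for the `t–t'–t''` model.** [cite: BratteliKishimotoRobinson1978, Thm. 2] -/
theorem IsMeanEnergyMinimiser.isGroundState_ttPrimeTPP
    (hmin : ω.IsMeanEnergyMinimiser (hubbardTT'T''FermionInteraction t t' t'' U) 2) :
    ω.IsGroundState (hubbardTT'T''FermionInteraction t t' t'' U) 2 :=
  hmin.isGroundState two_pos (hubbardTT'T''FermionInteraction_hasFiniteRange t t' t'' U)
    (hubbardTT'T''FermionInteraction_isHermitian t t' t'' U) (hubbardTT'T''FermionInteraction_isEven t t' t'' U)
    (hubbardTT'T''FermionInteraction_isTranslationInvariant t t' t'' U)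

/-- **Theorem 2 for the `t–t'–t''` Hubbard model on `ℤ²`** (range parameter `2`): minimiser of the mean
energy iff translation-invariant ground state. [cite: BratteliKishimotoRobinson1978, Thm. 2] -/
theorem isMeanEnergyMinimiser_ttPrimeTPP_iff :
    ω.IsMeanEnergyMinimiser (hubbardTT'T''FermionInteraction t t' t'' U) 2 ↔
      ω.IsTranslationInvariant ∧ ω.IsGroundState (hubbardTT'T''FermionInteraction t t' t'' U) 2 :=
  isMeanEnergyMinimiser_iff_isGroundState two_pos (hubbardTT'T''FermionInteraction_hasFiniteRange t t' t'' U)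
    (hubbardTT'T''FermionInteraction_isHermitian t t' t'' U) (hubbardTT'T''FermionInteraction_isEven t t' t'' U)
    (hubbardTT'T''FermionInteraction_isTranslationInvariant t t' t'' U)

/-- **`1 ⇒ 2` for the `t–t'–t''–t‴` model** (range `2`). [cite: BratteliKishimotoRobinson1978, Thm. 2] -/
theorem IsGroundState.isMeanEnergyMinimiser_ttPrimeTPPTPPP (hω : ω.IsTranslationInvariant)
    (hgs : ω.IsGroundState (hubbardTT'T''T'''FermionInteraction t t' t'' t''' U) 2) :
    ω.IsMeanEnergyMinimiser (hubbardTT'T''T'''FermionInteraction t t' t'' t''' U) 2 :=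
  hgs.isMeanEnergyMinimiser (hubbardTT'T''T'''FermionInteraction_hasFiniteRange t t' t'' t''' U)
    (hubbardTT'T''T'''FermionInteraction_isEven t t' t'' t''' U)
    (hubbardTT'T''T'''FermionInteraction_isTranslationInvariant t t' t'' t''' U) hω

/-- **`2 ⇒ 1` for the `t–t'–t''–t‴` model.** [cite: BratteliKishimotoRobinson1978, Thm. 2] -/
theorem IsMeanEnergyMinimiser.isGroundState_ttPrimeTPPTPPP
    (hmin : ω.IsMeanEnergyMinimiser (hubbardTT'T''T'''FermionInteraction t t' t'' t''' U) 2) :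
    ω.IsGroundState (hubbardTT'T''T'''FermionInteraction t t' t'' t''' U) 2 :=
  hmin.isGroundState two_pos (hubbardTT'T''T'''FermionInteraction_hasFiniteRange t t' t'' t''' U)
    (hubbardTT'T''T'''FermionInteraction_isHermitian t t' t'' t''' U)
    (hubbardTT'T''T'''FermionInteraction_isEven t t' t'' t''' U)
    (hubbardTT'T''T'''FermionInteraction_isTranslationInvariant t t' t'' t''' U)

/-- **Theorem 2 for the `t–t'–t''–t‴` Hubbard model on `ℤ²`** (range parameter `2`).
[cite: BratteliKishimotoRobinson1978, Thm. 2] -/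
theorem isMeanEnergyMinimiser_ttPrimeTPPTPPP_iff :
    ω.IsMeanEnergyMinimiser (hubbardTT'T''T'''FermionInteraction t t' t'' t''' U) 2 ↔
      ω.IsTranslationInvariant ∧ ω.IsGroundState (hubbardTT'T''T'''FermionInteraction t t' t'' t''' U) 2 :=
  isMeanEnergyMinimiser_iff_isGroundState two_pos
    (hubbardTT'T''T'''FermionInteraction_hasFiniteRange t t' t'' t''' U)
    (hubbardTT'T''T'''FermionInteraction_isHermitian t t' t'' t''' U)
    (hubbardTT'T''T'''FermionInteraction_isEven t t' t'' t''' U)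
    (hubbardTT'T''T'''FermionInteraction_isTranslationInvariant t t' t'' t''' U)

/-- **`1 ⇒ 2` for the pair-sourced `t–t'–t''` model** `Φ(t,t',U) − μn − hP_g + t''Φ''` (range `2`): every
translation-invariant ground state of object M minimises its mean energy.
[cite: BratteliKishimotoRobinson1978, Thm. 2] [cite: KomaTasaki1994, §1 (H_Λ − hO_Λ)] -/
theorem IsGroundState.isMeanEnergyMinimiser_ttPrimeTPPSourced (hω : ω.IsTranslationInvariant)
    (hgs : ω.IsGroundState (hubbardTT'T''SourcedInteraction t t' t'' U μ g h) 2) :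
    ω.IsMeanEnergyMinimiser (hubbardTT'T''SourcedInteraction t t' t'' U μ g h) 2 :=
  hgs.isMeanEnergyMinimiser (hubbardTT'T''SourcedInteraction_hasFiniteRange t t' t'' U μ g h)
    (hubbardTT'T''SourcedInteraction_isEven t t' t'' U μ g h)
    (hubbardTT'T''SourcedInteraction_isTranslationInvariant t t' t'' U μ g h) hω

/-- **`2 ⇒ 1` for the pair-sourced `t–t'–t''` model.** [cite: BratteliKishimotoRobinson1978, Thm. 2] -/
theorem IsMeanEnergyMinimiser.isGroundState_ttPrimeTPPSourced
    (hmin : ω.IsMeanEnergyMinimiser (hubbardTT'T''SourcedInteraction t t' t'' U μ g h) 2) :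
    ω.IsGroundState (hubbardTT'T''SourcedInteraction t t' t'' U μ g h) 2 :=
  hmin.isGroundState two_pos (hubbardTT'T''SourcedInteraction_hasFiniteRange t t' t'' U μ g h)
    (hubbardTT'T''SourcedInteraction_isHermitian t t' t'' U μ g h)
    (hubbardTT'T''SourcedInteraction_isEven t t' t'' U μ g h)
    (hubbardTT'T''SourcedInteraction_isTranslationInvariant t t' t'' U μ g h)

/-- **Theorem 2 for the pair-sourced `t–t'–t''` model** (object M with Koma–Tasaki's pair field; range
parameter `2`): at every source strength `h`, the minimisers of its mean energy are exactly its
translation-invariant ground states. [cite: BratteliKishimotoRobinson1978, Thm. 2]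
[cite: KomaTasaki1994, §1 (H_Λ − hO_Λ)] -/
theorem isMeanEnergyMinimiser_ttPrimeTPPSourced_iff :
    ω.IsMeanEnergyMinimiser (hubbardTT'T''SourcedInteraction t t' t'' U μ g h) 2 ↔
      ω.IsTranslationInvariant ∧ ω.IsGroundState (hubbardTT'T''SourcedInteraction t t' t'' U μ g h) 2 :=
  isMeanEnergyMinimiser_iff_isGroundState two_pos
    (hubbardTT'T''SourcedInteraction_hasFiniteRange t t' t'' U μ g h)
    (hubbardTT'T''SourcedInteraction_isHermitian t t' t'' U μ g h)
    (hubbardTT'T''SourcedInteraction_isEven t t' t'' U μ g h)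
    (hubbardTT'T''SourcedInteraction_isTranslationInvariant t t' t'' U μ g h)

end Square

end InfVolFermionState

/-! ### §5. More one-band families of the material boxes: uniaxial strain, anisotropic hopping, decoupled
layers (appended 2026-08-27, hubbard-pc-lit-1 g4)

`hubbardStrainedTTPrimeFermionInteraction tx ty t' U` (`HubbardHoppingFamilyLatticeSymmetry.lean`: hoppings
`t_x, t_y, t'`, the strained family at `θ = (t_x/2, t_y/2, t')`), `anisotropicHubbard U tx ty`
(`HubbardCoupledLadderArray.lean`: `Φ(0,U) + t_x Φ_{e₁} + t_y Φ_{e₂}`) and `decoupledLayers U t t'`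
(`HubbardBilayerByDecoration.lean`: the `t–t'–U` interaction on the stretched bonds `2e₁ | e₂`,
`2e₁ ± e₂`) are translation-invariant one-band families of range `1`, `1`, `2`; Theorem 2 by name for each. -/

section MoreFamilies

/-- The stretched first jumps `2e₁`, `2e₁ + e₂` are nonzero. [cite: PavariniEtAl2001, eq. (1)] -/
theorem layerPair₁_ne_zero (a : Fin 2) : layerPair₁ a ≠ 0 := by
  fin_cases a
  · exact axial2Vec_ne_zero 0
  · intro h
    have h0 := congrFun h 0
    simp [layerPair₁, axial2Vec, unitVec] at h0

/-- The stretched second jumps `e₂`, `2e₁ − e₂` are nonzero. [cite: PavariniEtAl2001, eq. (1)] -/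
theorem layerPair₂_ne_zero (a : Fin 2) : layerPair₂ a ≠ 0 := by
  fin_cases a
  · exact uvec_ne_zero 1
  · intro h
    have h0 := congrFun h 0
    simp [layerPair₂, axial2Vec, unitVec] at h0

variable (tx ty t t' U : ℝ)

/-- The uniaxially strained `t–t'–U` interaction is even. [cite: ArakiMoriya2003, §1 assumption (II)] -/
theorem hubbardStrainedTTPrimeFermionInteraction_isEven :
    (hubbardStrainedTTPrimeFermionInteraction tx ty t' U).IsEven :=
  hubbardHoppingFamily_isEven strainPair₁ strainPair₂ U _

/-- The uniaxially strained `t–t'–U` interaction is Hermitian. [cite: PavariniEtAl2001, eq. (1)] -/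
theorem hubbardStrainedTTPrimeFermionInteraction_isHermitian :
    (hubbardStrainedTTPrimeFermionInteraction tx ty t' U).IsHermitian :=
  hubbardHoppingFamily_isHermitian strainPair₁ strainPair₂ U _

/-- **The uniaxially strained `t–t'–U` interaction is translation invariant.**
[cite: ArakiMoriya2003, §1 assumption (IV) and §8] -/
theorem hubbardStrainedTTPrimeFermionInteraction_isTranslationInvariant :
    (hubbardStrainedTTPrimeFermionInteraction tx ty t' U).IsTranslationInvariant :=
  hubbardHoppingFamily_isTranslationInvariant (fun a => ⟨strainPair₁_ne_zero a, strainPair₂_ne_zero a⟩) U _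

/-- **The uniaxially strained `t–t'–U` interaction has range `1`.** [cite: ArakiMoriya2003, §5.4 (finite range potentials)] -/
theorem hubbardStrainedTTPrimeFermionInteraction_hasFiniteRange :
    (hubbardStrainedTTPrimeFermionInteraction tx ty t' U).HasFiniteRange 1 :=
  hubbardHoppingFamily_hasFiniteRange zero_le_one
    (fun a => ⟨norm_le_of_mem_thicken_zero zero_le_one (strainPair₁_mem_thicken_one a),
      norm_le_of_mem_thicken_zero zero_le_one (strainPair₂_mem_thicken_one a)⟩) U _

/-- The anisotropic square-lattice Hubbard interaction is even. [cite: ArakiMoriya2003, §1 assumption (II)] -/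
theorem anisotropicHubbard_isEven : (anisotropicHubbard U tx ty).IsEven :=
  FermionInteraction.isEven_linearFamily (hubbardFermionInteraction_isEven 0 U)
    (fun a => by fin_cases a <;> exact vectorHoppingFermionInteraction_isEven _ 1) _

/-- The anisotropic square-lattice Hubbard interaction is Hermitian. [cite: PavariniEtAl2001, eq. (1)] -/
theorem anisotropicHubbard_isHermitian : (anisotropicHubbard U tx ty).IsHermitian :=
  FermionInteraction.isHermitian_linearFamily (hubbardFermionInteraction_isHermitian 0 U)
    (fun a => by fin_cases a <;> exact vectorHoppingFermionInteraction_isHermitian _ 1) _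

/-- **The anisotropic square-lattice Hubbard interaction is translation invariant.**
[cite: ArakiMoriya2003, §1 assumption (IV) and §8] -/
theorem anisotropicHubbard_isTranslationInvariant : (anisotropicHubbard U tx ty).IsTranslationInvariant :=
  FermionInteraction.isTranslationInvariant_linearFamily (hubbardFermionInteraction_isTranslationInvariant 0 U)
    (fun a => by
      fin_cases a
      · exact vectorHoppingFermionInteraction_isTranslationInvariant (uvec_ne_zero 0) 1
      · exact vectorHoppingFermionInteraction_isTranslationInvariant (uvec_ne_zero 1) 1) _

/-- **The anisotropic square-lattice Hubbard interaction has range `1`.** [cite: ArakiMoriya2003, §5.4 (finite range potentials)] -/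
theorem anisotropicHubbard_hasFiniteRange : (anisotropicHubbard U tx ty).HasFiniteRange 1 :=
  FermionInteraction.hasFiniteRange_linearFamily
    ((hubbardFermionInteraction_hasFiniteRange_zero_of_hopping_zero U).of_le zero_le_one)
    (fun a => by
      fin_cases a
      · exact (vectorHoppingFermionInteraction_hasFiniteRange (unitVec 0) 1).of_le (norm_unitVec_site 0).le
      · exact (vectorHoppingFermionInteraction_hasFiniteRange (unitVec 1) 1).of_le (norm_unitVec_site 1).le) _

/-- The decoupled-layers interaction is even. [cite: ArakiMoriya2003, §1 assumption (II)] -/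
theorem decoupledLayers_isEven : (decoupledLayers U t t').IsEven :=
  hubbardHoppingFamily_isEven layerPair₁ layerPair₂ U _

/-- The decoupled-layers interaction is Hermitian. [cite: PavariniEtAl2001, eq. (1)] -/
theorem decoupledLayers_isHermitian : (decoupledLayers U t t').IsHermitian :=
  hubbardHoppingFamily_isHermitian layerPair₁ layerPair₂ U _

/-- **The decoupled-layers interaction is translation invariant** (by all of `ℤ²`: the stretched bonds are
translates of one another). [cite: ArakiMoriya2003, §1 assumption (IV) and §8] -/
theorem decoupledLayers_isTranslationInvariant : (decoupledLayers U t t').IsTranslationInvariant :=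
  hubbardHoppingFamily_isTranslationInvariant (fun a => ⟨layerPair₁_ne_zero a, layerPair₂_ne_zero a⟩) U _

/-- **The decoupled-layers interaction has range `2`.** [cite: ArakiMoriya2003, §5.4 (finite range potentials)] -/
theorem decoupledLayers_hasFiniteRange : (decoupledLayers U t t').HasFiniteRange 2 :=
  hubbardHoppingFamily_hasFiniteRange zero_le_two
    (fun a => ⟨norm_le_of_mem_thicken_zero zero_le_two (layerPair₁_mem_thicken_two a),
      norm_le_of_mem_thicken_zero zero_le_two (layerPair₂_mem_thicken_two a)⟩) U _

end MoreFamilies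

namespace InfVolFermionState

section MoreFamilies

variable {tx ty t t' U : ℝ} {ω : InfVolFermionState 2}

/-- **Theorem 2 for the uniaxially strained `t–t'–U` model** (range parameter `1`): minimiser of the mean
energy iff translation-invariant ground state. [cite: BratteliKishimotoRobinson1978, Thm. 2] -/
theorem isMeanEnergyMinimiser_strainedTTPrime_iff :
    ω.IsMeanEnergyMinimiser (hubbardStrainedTTPrimeFermionInteraction tx ty t' U) 1 ↔
      ω.IsTranslationInvariant ∧ ω.IsGroundState (hubbardStrainedTTPrimeFermionInteraction tx ty t' U) 1 :=
  isMeanEnergyMinimiser_iff_isGroundState two_pos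
    (hubbardStrainedTTPrimeFermionInteraction_hasFiniteRange tx ty t' U)
    (hubbardStrainedTTPrimeFermionInteraction_isHermitian tx ty t' U)
    (hubbardStrainedTTPrimeFermionInteraction_isEven tx ty t' U)
    (hubbardStrainedTTPrimeFermionInteraction_isTranslationInvariant tx ty t' U)

/-- `1 ⇒ 2` for the uniaxially strained `t–t'–U` model. [cite: BratteliKishimotoRobinson1978, Thm. 2] -/
theorem IsGroundState.isMeanEnergyMinimiser_strainedTTPrime (hω : ω.IsTranslationInvariant)
    (hgs : ω.IsGroundState (hubbardStrainedTTPrimeFermionInteraction tx ty t' U) 1) :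
    ω.IsMeanEnergyMinimiser (hubbardStrainedTTPrimeFermionInteraction tx ty t' U) 1 :=
  isMeanEnergyMinimiser_strainedTTPrime_iff.2 ⟨hω, hgs⟩

/-- `2 ⇒ 1` for the uniaxially strained `t–t'–U` model. [cite: BratteliKishimotoRobinson1978, Thm. 2] -/
theorem IsMeanEnergyMinimiser.isGroundState_strainedTTPrime
    (hmin : ω.IsMeanEnergyMinimiser (hubbardStrainedTTPrimeFermionInteraction tx ty t' U) 1) :
    ω.IsGroundState (hubbardStrainedTTPrimeFermionInteraction tx ty t' U) 1 :=
  (isMeanEnergyMinimiser_strainedTTPrime_iff.1 hmin).2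

/-- **Theorem 2 for the anisotropic square-lattice Hubbard model** `Φ(0,U) + t_x Φ_{e₁} + t_y Φ_{e₂}`
(range parameter `1`). [cite: BratteliKishimotoRobinson1978, Thm. 2] -/
theorem isMeanEnergyMinimiser_anisotropicHubbard_iff :
    ω.IsMeanEnergyMinimiser (anisotropicHubbard U tx ty) 1 ↔
      ω.IsTranslationInvariant ∧ ω.IsGroundState (anisotropicHubbard U tx ty) 1 :=
  isMeanEnergyMinimiser_iff_isGroundState two_pos (anisotropicHubbard_hasFiniteRange tx ty U)
    (anisotropicHubbard_isHermitian tx ty U) (anisotropicHubbard_isEven tx ty U)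
    (anisotropicHubbard_isTranslationInvariant tx ty U)

/-- `1 ⇒ 2` for the anisotropic square-lattice Hubbard model. [cite: BratteliKishimotoRobinson1978, Thm. 2] -/
theorem IsGroundState.isMeanEnergyMinimiser_anisotropicHubbard (hω : ω.IsTranslationInvariant)
    (hgs : ω.IsGroundState (anisotropicHubbard U tx ty) 1) :
    ω.IsMeanEnergyMinimiser (anisotropicHubbard U tx ty) 1 :=
  isMeanEnergyMinimiser_anisotropicHubbard_iff.2 ⟨hω, hgs⟩

/-- `2 ⇒ 1` for the anisotropic square-lattice Hubbard model. [cite: BratteliKishimotoRobinson1978, Thm. 2] -/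
theorem IsMeanEnergyMinimiser.isGroundState_anisotropicHubbard
    (hmin : ω.IsMeanEnergyMinimiser (anisotropicHubbard U tx ty) 1) :
    ω.IsGroundState (anisotropicHubbard U tx ty) 1 :=
  (isMeanEnergyMinimiser_anisotropicHubbard_iff.1 hmin).2

/-- **Theorem 2 for the decoupled-layers interaction** (range parameter `2`).
[cite: BratteliKishimotoRobinson1978, Thm. 2] -/
theorem isMeanEnergyMinimiser_decoupledLayers_iff :
    ω.IsMeanEnergyMinimiser (decoupledLayers U t t') 2 ↔
      ω.IsTranslationInvariant ∧ ω.IsGroundState (decoupledLayers U t t') 2 :=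
  isMeanEnergyMinimiser_iff_isGroundState two_pos (decoupledLayers_hasFiniteRange t t' U)
    (decoupledLayers_isHermitian t t' U) (decoupledLayers_isEven t t' U)
    (decoupledLayers_isTranslationInvariant t t' U)

/-- `1 ⇒ 2` for the decoupled-layers interaction. [cite: BratteliKishimotoRobinson1978, Thm. 2] -/
theorem IsGroundState.isMeanEnergyMinimiser_decoupledLayers (hω : ω.IsTranslationInvariant)
    (hgs : ω.IsGroundState (decoupledLayers U t t') 2) :
    ω.IsMeanEnergyMinimiser (decoupledLayers U t t') 2 :=
  isMeanEnergyMinimiser_decoupledLayers_iff.2 ⟨hω, hgs⟩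

/-- `2 ⇒ 1` for the decoupled-layers interaction. [cite: BratteliKishimotoRobinson1978, Thm. 2] -/
theorem IsMeanEnergyMinimiser.isGroundState_decoupledLayers
    (hmin : ω.IsMeanEnergyMinimiser (decoupledLayers U t t') 2) :
    ω.IsGroundState (decoupledLayers U t t') 2 :=
  (isMeanEnergyMinimiser_decoupledLayers_iff.1 hmin).2

end MoreFamilies

end InfVolFermionState

end Literature.MathematicalPhysics.QuantumLattice

end
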